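import Summits.CriticalPhenomena.Ising3DConformalLimit.Theorems.PerfectScreeningSubharmonicOffOriginKlBandDefs

/-!
# Crux `PerfectScreening.SubharmonicOffOrigin` (stmt-CriticalPhenomena-1341), line
`kl-band-positivity`: stub `stub_layerKernel` (the LAYER KERNELS)

This file proves the registered stub `stub_layerKernel : Sig.stub_layerKernel` of the checked
skeleton of the line `kl-band-positivity` (objects and signatures in
`PerfectScreeningSubharmonicOffOriginKlBandDefs`): for every massive rate `θ ∈ (0,1)` and every
`n : ℕ` there is a NONNEGATIVE SUMMABLE kernel `P` on `ℤ²` whose cosine series is the `n`-th power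
of the iso-mass layer symbol, `∑_y P(y) cos(k·y) = λ_θ(k)ⁿ` for every `k ∈ ℝ²`.

Proof (elementary; the kernel is the massive half-space Poisson kernel of the killed simple random
walk on `ℤ³ = ℤ × ℤ²`, built as the MINIMAL nonnegative solution of its defining linear recursion,
and identified on the Fourier side by uniqueness of bounded solutions of a three-term recursion):
* `layerKer_kernel_exists`: with `w = (θ + θ⁻¹ + 4)⁻¹`, the monotone iteration
  `K⁽ᵐ⁺¹⁾₀ = δ₀`, `K⁽ᵐ⁺¹⁾ₙ₊₁(y) = w (K⁽ᵐ⁾ₙ₊₂(y) + K⁽ᵐ⁾ₙ(y) + ∑_{e} K⁽ᵐ⁾ₙ₊₁(y + e))` (`e` the four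
  transverse unit vectors), started at `K⁽⁰⁾ = 0`, is nondecreasing in `m` with layer masses
  `∑_y K⁽ᵐ⁾ₙ(y) ≤ θⁿ` (induction: `w (θⁿ⁺² + θⁿ + 4θⁿ⁺¹) = θⁿ⁺¹`), so its pointwise limit `Pₙ ≥ 0`
  has finite partial sums `≤ θⁿ` (hence is summable) and solves the recursion exactly, `P₀ = δ₀`.
* `layerKer_tsum_neighbours`: on the cosine side the transverse neighbour sum is multiplication by
  `∑ⱼ 2cos kⱼ = 4 − k̂²` (`cos(k·(y+eⱼ)) + cos(k·(y−eⱼ)) = 2cos kⱼ cos(k·y)`), so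
  `Fₙ(k) = ∑_y Pₙ(y) cos(k·y)` obeys `F₀ = 1`, `|Fₙ| ≤ θⁿ ≤ 1` and
  `Fₙ₊₂ = (θ + θ⁻¹ + k̂²) Fₙ₊₁ − Fₙ`.
* `layerKer_identify`: `λ = λ_θ(k) ∈ (0,1)` is a root of `λ² − (θ + θ⁻¹ + k̂²)λ + 1 = 0`
  (`layerSymbol_quadratic`), the other root being `μ = 1/λ > 1`; for `Dₙ = Fₙ − λⁿ` one has
  `(μ − λ) Dₙ = D₁ (μⁿ − λⁿ)` with `Dₙ` bounded and `μⁿ → ∞`, forcing `D₁ = 0`, hence `Fₙ = λⁿ`.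

References: the layer (first-entrance) kernels of the transfer matrix of the Gaussian / random-walk
model are classical (Spitzer, *Principles of Random Walk* (1976) §19; Glimm–Jaffe,
*Quantum Physics* (1987) §6.1, §7.10); everything used here is elementary real analysis from
Mathlib.
-/

noncomputable section

open MeasureTheory ProbabilityTheory
open Literature.Probability.LatticeModels
open Filter Topology

namespace Summit.CriticalPhenomena.Ising3DConformalLimit.Theorems.PerfectScreening.KlBand

/-! ## The layer symbol as the small root of its quadratic -/

/-- For `θ > 0`, `λ = λ_θ(k)` solves the monic quadratic `λ² − (θ + θ⁻¹ + k̂²)λ + 1 = 0`. -/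
theorem layerKer_symbol_quadratic {θ : ℝ} (hθ : 0 < θ) (k : Fin 2 → ℝ) :
    layerSymbol θ k ^ 2 - (θ + θ⁻¹ + khatSq k) * layerSymbol θ k + 1 = 0 := by
  have h := layerSymbol_quadratic θ hθ k
  have hθ' : θ ≠ 0 := hθ.ne'
  have : layerSymbol θ k ^ 2 - (θ + θ⁻¹ + khatSq k) * layerSymbol θ k + 1
      = θ⁻¹ * (θ * layerSymbol θ k ^ 2 - (1 + θ ^ 2 + θ * khatSq k) * layerSymbol θ k + θ) := by
    field_simp
    ring
  rw [this, h, mul_zero]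

/-- `0 < λ_θ(k)` for `θ > 0`. -/
theorem layerKer_symbol_pos {θ : ℝ} (hθ : 0 < θ) (k : Fin 2 → ℝ) : 0 < layerSymbol θ k := by
  unfold layerSymbol
  have h1 : 0 ≤ θ * khatSq k := mul_nonneg hθ.le (khatSq_nonneg k)
  have h2 := Real.sqrt_nonneg ((1 + θ ^ 2 + θ * khatSq k) ^ 2 - 4 * θ ^ 2)
  have h3 := sq_nonneg θ
  exact div_pos (by linarith) (by linarith)

/-- `λ_θ(k) < 1` for a MASSIVE rate `θ ∈ (0,1)` (`B − 2θ = (1−θ)² + θk̂² > 0`). -/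
theorem layerKer_symbol_lt_one {θ : ℝ} (hθ : 0 < θ) (hθ1 : θ < 1) (k : Fin 2 → ℝ) :
    layerSymbol θ k < 1 := by
  unfold layerSymbol
  have h1 : 0 ≤ θ * khatSq k := mul_nonneg hθ.le (khatSq_nonneg k)
  have h2 := Real.sqrt_nonneg ((1 + θ ^ 2 + θ * khatSq k) ^ 2 - 4 * θ ^ 2)
  have h3 := sq_nonneg θ
  rw [div_lt_one (by linarith)]
  nlinarith [mul_pos (sub_pos.2 hθ1) (sub_pos.2 hθ1)]

/-- **Uniqueness of bounded solutions of the fibre recursion.** If `F 0 = 1`, `|F n| ≤ 1` and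
`F (n+2) = (θ + θ⁻¹ + k̂²) F (n+1) − F n` for a massive rate `θ ∈ (0,1)`, then `F n = λ_θ(k)ⁿ`:
with `λ = λ_θ(k) ∈ (0,1)`, `μ = λ⁻¹ > 1` the two roots of the characteristic quadratic,
`(μ − λ)(F n − λⁿ) = (F 1 − λ)(μⁿ − λⁿ)`, and `μⁿ` is unbounded. -/
theorem layerKer_identify {θ : ℝ} (hθ : 0 < θ) (hθ1 : θ < 1) (k : Fin 2 → ℝ) (F : ℕ → ℝ)
    (h0 : F 0 = 1) (hb : ∀ n, |F n| ≤ 1)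
    (hrec : ∀ n, F (n + 2) = (θ + θ⁻¹ + khatSq k) * F (n + 1) - F n) (n : ℕ) :
    F n = layerSymbol θ k ^ n := by
  set T := θ + θ⁻¹ + khatSq k with hT
  set l := layerSymbol θ k with hl
  have hl0 : 0 < l := layerKer_symbol_pos hθ k
  have hl1 : l < 1 := layerKer_symbol_lt_one hθ hθ1 k
  have hq : l ^ 2 - T * l + 1 = 0 := layerKer_symbol_quadratic hθ k
  set μ := l⁻¹ with hμ
  have hμ1 : 1 < μ := (one_lt_inv₀ hl0).2 hl1
  have hqμ : μ ^ 2 - T * μ + 1 = 0 := by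
    have : μ ^ 2 - T * μ + 1 = μ ^ 2 * (l ^ 2 - T * l + 1) := by
      rw [hμ]; field_simp; ring
    rw [this, hq, mul_zero]
  have el : ∀ m : ℕ, l ^ (m + 2) = T * l ^ (m + 1) - l ^ m := fun m => by
    have : l ^ (m + 2) - (T * l ^ (m + 1) - l ^ m) = l ^ m * (l ^ 2 - T * l + 1) := by ring
    rw [hq, mul_zero] at this
    linarith
  have eμ : ∀ m : ℕ, μ ^ (m + 2) = T * μ ^ (m + 1) - μ ^ m := fun m => by
    have : μ ^ (m + 2) - (T * μ ^ (m + 1) - μ ^ m) = μ ^ m * (μ ^ 2 - T * μ + 1) := by ring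
    rw [hqμ, mul_zero] at this
    linarith
  -- the closed form of the deviation `F m - l ^ m`
  have hD : ∀ m, (μ - l) * (F m - l ^ m) = (F 1 - l) * (μ ^ m - l ^ m) := by
    have key : ∀ m, (μ - l) * (F m - l ^ m) = (F 1 - l) * (μ ^ m - l ^ m) ∧
        (μ - l) * (F (m + 1) - l ^ (m + 1)) = (F 1 - l) * (μ ^ (m + 1) - l ^ (m + 1)) := by
      intro m
      induction m with
      | zero => exact ⟨by simp [h0], by rw [zero_add, pow_one, pow_one]; ring⟩
      | succ m ih =>
        refine ⟨ih.2, ?_⟩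
        rw [hrec m, el m, eμ m]
        linear_combination T * ih.2 - ih.1
    exact fun m => (key m).1
  -- boundedness forces `F 1 = l`
  have hF1 : F 1 = l := by
    by_contra hne
    have hpos : 0 < |F 1 - l| := abs_pos.2 (sub_ne_zero.2 hne)
    obtain ⟨N, hN⟩ := pow_unbounded_of_one_lt (2 * (μ - l) / |F 1 - l| + 1) hμ1
    have h2 : |F N - l ^ N| ≤ 2 := by
      have hFN := hb N
      have hlN : |l ^ N| ≤ 1 := by
        rw [abs_of_nonneg (pow_nonneg hl0.le _)]; exact pow_le_one₀ hl0.le hl1.le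
      calc |F N - l ^ N| ≤ |F N| + |l ^ N| := abs_sub _ _
        _ ≤ 2 := by linarith
    have h3 : l ^ N ≤ 1 := pow_le_one₀ hl0.le hl1.le
    have h4 : |F 1 - l| * (μ ^ N - l ^ N) ≤ (μ - l) * 2 := by
      have hmono : l ^ N ≤ μ ^ N := pow_le_pow_left₀ hl0.le (hl1.le.trans hμ1.le) N
      have : |F 1 - l| * (μ ^ N - l ^ N) = |(μ - l) * (F N - l ^ N)| := by
        rw [hD N, abs_mul, abs_of_nonneg (sub_nonneg.2 hmono)]
      rw [this, abs_mul, abs_of_pos (by linarith : 0 < μ - l)]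
      exact mul_le_mul_of_nonneg_left h2 (by linarith)
    have h5 : μ ^ N - l ^ N ≤ 2 * (μ - l) / |F 1 - l| := by
      rw [le_div_iff₀ hpos]; linarith
    linarith
  have hfin := hD n
  rw [hF1, sub_self, zero_mul] at hfin
  have hμl : μ - l ≠ 0 := ne_of_gt (by linarith)
  have := (mul_eq_zero.1 hfin).resolve_left hμl
  linarith

/-! ## The minimal solution of the layer recursion -/

/-- The iterates of the monotone scheme exist (plain recursion on the iteration index `m`):
`I 0 = 0`, `I (m+1) 0 = δ₀`,
`I (m+1) (n+1) y = w (I m (n+2) y + I m n y + ∑ⱼ (I m (n+1) (y + eⱼ) + I m (n+1) (y − eⱼ)))`. -/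
theorem layerKer_iterates (w : ℝ) :
    ∃ I : ℕ → ℕ → (Fin 2 → ℤ) → ℝ, (∀ n y, I 0 n y = 0) ∧
      (∀ m y, I (m + 1) 0 y = if y = 0 then 1 else 0) ∧
      ∀ m n y, I (m + 1) (n + 1) y = w * (I m (n + 2) y + I m n y +
        ∑ j, (I m (n + 1) (y + Pi.single j 1) + I m (n + 1) (y - Pi.single j 1))) := by
  let step : (ℕ → (Fin 2 → ℤ) → ℝ) → ℕ → (Fin 2 → ℤ) → ℝ := fun K n y =>
    match n with
    | 0 => if y = 0 then 1 else 0
    | n' + 1 => w * (K (n' + 2) y + K n' y +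
        ∑ j, (K (n' + 1) (y + Pi.single j 1) + K (n' + 1) (y - Pi.single j 1)))
  exact ⟨fun m => Nat.rec (fun _ _ => 0) (fun _ K => step K) m, fun _ _ => rfl, fun _ _ => rfl,
    fun _ _ _ => rfl⟩

/-- **Existence of the layer kernels.** For `θ > 0` and `w = (θ + θ⁻¹ + 4)⁻¹` there is a family of
nonnegative kernels `P n` on `ℤ²` with finite partial sums `∑_{y ∈ u} P n y ≤ θⁿ`, `P 0 = δ₀`,
solving the layer recursion
`P (n+1) y = w (P (n+2) y + P n y + ∑ⱼ (P (n+1) (y+eⱼ) + P (n+1) (y−eⱼ)))`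
(the pointwise limit of the monotone iteration `layerKer_iterates`). -/
theorem layerKer_kernel_exists {θ : ℝ} (hθ : 0 < θ) :
    ∃ P : ℕ → (Fin 2 → ℤ) → ℝ, (∀ n y, 0 ≤ P n y) ∧
      (∀ n (u : Finset (Fin 2 → ℤ)), ∑ y ∈ u, P n y ≤ θ ^ n) ∧
      (∀ y, P 0 y = if y = 0 then 1 else 0) ∧
      ∀ n y, P (n + 1) y = (θ + θ⁻¹ + 4)⁻¹ * (P (n + 2) y + P n y +
        ∑ j, (P (n + 1) (y + Pi.single j 1) + P (n + 1) (y - Pi.single j 1))) := by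
  set w := (θ + θ⁻¹ + 4)⁻¹ with hw_def
  have hw0 : 0 ≤ w := by positivity
  have hwθ : w * (θ ^ 2 + 1 + 4 * θ) = θ := by
    rw [hw_def]; field_simp
  obtain ⟨I, hI0, hI1, hI2⟩ := layerKer_iterates w
  -- the iteration is nondecreasing
  have hmono : ∀ m n y, I m n y ≤ I (m + 1) n y := by
    intro m
    induction m with
    | zero =>
      intro n y
      rw [hI0]
      cases n with
      | zero => rw [hI1]; split_ifs <;> norm_num
      | succ n => rw [hI2]; simp [hI0]
    | succ m ih =>
      intro n y
      cases n with
      | zero => rw [hI1, hI1]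
      | succ n =>
        rw [hI2, hI2]
        refine mul_le_mul_of_nonneg_left ?_ hw0
        gcongr <;> apply ih
  have hmono' : ∀ n y, Monotone fun m => I m n y := fun n y =>
    monotone_nat_of_le_succ fun m => hmono m n y
  -- finite layer masses of the iterates
  have hmass : ∀ m n (u : Finset (Fin 2 → ℤ)), ∑ y ∈ u, I m n y ≤ θ ^ n := by
    intro m
    induction m with
    | zero => intro n u; simp only [hI0, Finset.sum_const_zero]; positivity
    | succ m ih =>
      intro n u
      cases n with
      | zero =>
        simp only [hI1, Finset.sum_ite_eq', pow_zero]
        split_ifs <;> norm_num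
      | succ n =>
        have hadd : ∀ j : Fin 2, ∑ y ∈ u, I m (n + 1) (y + Pi.single j 1) ≤ θ ^ (n + 1) := by
          intro j
          have := ih (n + 1) (u.map (Equiv.addRight (Pi.single j (1 : ℤ))).toEmbedding)
          rwa [Finset.sum_map] at this
        have hsub : ∀ j : Fin 2, ∑ y ∈ u, I m (n + 1) (y - Pi.single j 1) ≤ θ ^ (n + 1) := by
          intro j
          have := ih (n + 1) (u.map (Equiv.subRight (Pi.single j (1 : ℤ))).toEmbedding)
          rwa [Finset.sum_map] at this
        have hC : ∑ y ∈ u, ∑ j, I m (n + 1) (y + Pi.single j 1)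
            = ∑ j, ∑ y ∈ u, I m (n + 1) (y + Pi.single j 1) := Finset.sum_comm
        have hD : ∑ y ∈ u, ∑ j, I m (n + 1) (y - Pi.single j 1)
            = ∑ j, ∑ y ∈ u, I m (n + 1) (y - Pi.single j 1) := Finset.sum_comm
        simp only [hI2, ← Finset.mul_sum, Finset.sum_add_distrib, hC, hD]
        calc _ ≤ w * (θ ^ (n + 2) + θ ^ n +
              (∑ _j : Fin 2, θ ^ (n + 1) + ∑ _j : Fin 2, θ ^ (n + 1))) := by
              refine mul_le_mul_of_nonneg_left ?_ hw0
              gcongr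
              · exact ih _ _
              · exact ih _ _
              · exact hadd _
              · exact hsub _
          _ = θ ^ n * (w * (θ ^ 2 + 1 + 4 * θ)) := by simp only [Fin.sum_univ_two]; ring
          _ = θ ^ (n + 1) := by rw [hwθ]; ring
  -- pointwise bounds and the pointwise (monotone) limit
  have hbd : ∀ m n y, I m n y ≤ θ ^ n := fun m n y => by simpa using hmass m n {y}
  have hBdd : ∀ n y, BddAbove (Set.range fun m => I m n y) := fun n y =>
    ⟨θ ^ n, by rintro _ ⟨m, rfl⟩; exact hbd m n y⟩
  have htend : ∀ n y, Tendsto (fun m => I m n y) atTop (𝓝 (⨆ m, I m n y)) := fun n y =>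
    tendsto_atTop_ciSup (hmono' n y) (hBdd n y)
  refine ⟨fun n y => ⨆ m, I m n y, fun n y => le_ciSup_of_le (hBdd n y) 0 (hI0 n y).ge,
    fun n u => ?_, fun y => ?_, fun n y => ?_⟩
  · exact le_of_tendsto' (tendsto_finsetSum u fun y _ => htend n y) fun m => hmass m n u
  · refine tendsto_nhds_unique (htend 0 y) ?_
    refine (tendsto_add_atTop_iff_nat 1).1 ?_
    simp only [hI1]
    exact tendsto_const_nhds
  · refine tendsto_nhds_unique (htend (n + 1) y) ?_
    refine (tendsto_add_atTop_iff_nat 1).1 ?_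
    simp only [hI2]
    exact (((htend _ _).add (htend _ _)).add
      (tendsto_finsetSum _ fun j _ => (htend _ _).add (htend _ _))).const_mul w

/-! ## The cosine side -/

/-- `cos(k·(y+eⱼ)) + cos(k·(y−eⱼ)) = 2cos kⱼ cos(k·y)`. -/
theorem layerKer_cos_neighbours (k : Fin 2 → ℝ) (y : Fin 2 → ℤ) (j : Fin 2) :
    Real.cos (phase k (y + Pi.single j 1)) + Real.cos (phase k (y - Pi.single j 1))
      = 2 * Real.cos (k j) * Real.cos (phase k y) := by
  have h1 : phase k (y + Pi.single j 1) = phase k y + k j := by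
    simp [phase, Pi.add_apply, Int.cast_add, mul_add, Finset.sum_add_distrib, Pi.single_apply]
  have h2 : phase k (y - Pi.single j 1) = phase k y - k j := by
    simp [phase, Pi.sub_apply, Int.cast_sub, mul_sub, Finset.sum_sub_distrib, Pi.single_apply]
  rw [h1, h2, Real.cos_add, Real.cos_sub]
  ring

/-- A nonnegative summable kernel times a cosine is summable. -/
theorem layerKer_summable_mul_cos {K : (Fin 2 → ℤ) → ℝ} (hK : Summable K) (hK0 : ∀ y, 0 ≤ K y)
    (g : (Fin 2 → ℤ) → ℝ) : Summable fun y => K y * Real.cos (g y) :=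
  Summable.of_norm_bounded hK fun y => by
    rw [norm_mul, Real.norm_eq_abs, Real.norm_eq_abs, abs_of_nonneg (hK0 y)]
    exact mul_le_of_le_one_right (hK0 y) (Real.abs_cos_le_one _)

/-- **Cosine transform of the transverse neighbour sum**: multiplication by `4 − k̂²(k)`. -/
theorem layerKer_tsum_neighbours {K : (Fin 2 → ℤ) → ℝ} (hK : Summable K) (hK0 : ∀ y, 0 ≤ K y)
    (k : Fin 2 → ℝ) :
    ∑' y, (∑ j, (K (y + Pi.single j 1) + K (y - Pi.single j 1))) * Real.cos (phase k y)
      = (4 - khatSq k) * ∑' y, K y * Real.cos (phase k y) := by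
  have hsa : ∀ e : Fin 2 → ℤ, Summable fun y => K (y + e) := fun e =>
    (Equiv.addRight e).summable_iff.2 hK
  have hss : ∀ e : Fin 2 → ℤ, Summable fun y => K (y - e) := fun e =>
    (Equiv.subRight e).summable_iff.2 hK
  have hca : ∀ e : Fin 2 → ℤ, Summable fun y => K (y + e) * Real.cos (phase k y) := fun e =>
    layerKer_summable_mul_cos (hsa e) (fun y => hK0 _) _
  have hcs : ∀ e : Fin 2 → ℤ, Summable fun y => K (y - e) * Real.cos (phase k y) := fun e =>
    layerKer_summable_mul_cos (hss e) (fun y => hK0 _) _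
  -- shift the summation variable
  have hsha : ∀ e : Fin 2 → ℤ, ∑' y, K (y + e) * Real.cos (phase k y)
      = ∑' y, K y * Real.cos (phase k (y - e)) := fun e => by
    rw [← (Equiv.addRight e).tsum_eq fun y => K y * Real.cos (phase k (y - e))]
    simp
  have hshs : ∀ e : Fin 2 → ℤ, ∑' y, K (y - e) * Real.cos (phase k y)
      = ∑' y, K y * Real.cos (phase k (y + e)) := fun e => by
    rw [← (Equiv.subRight e).tsum_eq fun y => K y * Real.cos (phase k (y + e))]
    simp
  have hpt : ∀ y, (∑ j, (K (y + Pi.single j 1) + K (y - Pi.single j 1))) * Real.cos (phase k y)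
      = ∑ j, (K (y + Pi.single j 1) * Real.cos (phase k y)
          + K (y - Pi.single j 1) * Real.cos (phase k y)) := fun y => by
    rw [Finset.sum_mul]
    refine Finset.sum_congr rfl fun j _ => ?_
    ring
  simp_rw [hpt]
  rw [Summable.tsum_finsetSum fun j _ => (hca _).add (hcs _)]
  have hj : ∀ j : Fin 2, ∑' y, (K (y + Pi.single j 1) * Real.cos (phase k y)
      + K (y - Pi.single j 1) * Real.cos (phase k y))
      = 2 * Real.cos (k j) * ∑' y, K y * Real.cos (phase k y) := fun j => by
    rw [(hca _).tsum_add (hcs _), hsha, hshs, ← tsum_mul_left,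
      ← ((layerKer_summable_mul_cos hK hK0 _)).tsum_add (layerKer_summable_mul_cos hK hK0 _)]
    refine tsum_congr fun y => ?_
    have := layerKer_cos_neighbours k y j
    linear_combination K y * this
  simp_rw [hj]
  rw [← Finset.sum_mul]
  congr 1
  simp only [khatSq, Fin.sum_univ_two]
  ring

/-! ## The stub -/

/-- **Stub 5 of line `kl-band-positivity` (LAYER KERNELS).** For every massive rate `θ ∈ (0,1)` and
every `n`, `λ_θ(·)ⁿ` is the cosine series of a nonnegative summable kernel on `ℤ²` (the `n`-th layer
kernel `P n` of `layerKer_kernel_exists`; its cosine transform obeys the fibre recursion by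
`layerKer_tsum_neighbours` and is identified with `λ_θⁿ` by `layerKer_identify`). -/
theorem stub_layerKernel : Sig.stub_layerKernel := by
  intro θ hθ n
  obtain ⟨hθ0, hθ1⟩ := hθ
  obtain ⟨P, hP0, hPle, hPzero, hPrec⟩ := layerKer_kernel_exists hθ0
  have hsum : ∀ m, Summable (P m) := fun m => summable_of_sum_le (fun y => hP0 m y) (hPle m)
  refine ⟨P n, hP0 n, hsum n, fun k => ?_⟩
  have hFs : ∀ m, Summable fun y => P m y * Real.cos (phase k y) := fun m =>
    layerKer_summable_mul_cos (hsum m) (hP0 m) _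
  have key : ∀ m, ∑' y, P m y * Real.cos (phase k y) = layerSymbol θ k ^ m := by
    refine layerKer_identify hθ0 hθ1 k (fun m => ∑' y, P m y * Real.cos (phase k y)) ?_ ?_ ?_
    · simp only [hPzero, ite_mul, one_mul, zero_mul]
      rw [tsum_ite_eq]
      simp [phase]
    · intro m
      have h1 : |∑' y, P m y * Real.cos (phase k y)| ≤ ∑' y, P m y := by
        rw [← Real.norm_eq_abs]
        refine (norm_tsum_le_tsum_norm (hFs m).norm).trans ?_
        refine ((hFs m).norm).tsum_le_tsum (fun y => ?_) (hsum m)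
        rw [norm_mul, Real.norm_eq_abs, Real.norm_eq_abs, abs_of_nonneg (hP0 m y)]
        exact mul_le_of_le_one_right (hP0 m y) (Real.abs_cos_le_one _)
      have h2 : ∑' y, P m y ≤ θ ^ m := Real.tsum_le_of_sum_le (fun y => hP0 m y) (hPle m)
      have h3 : θ ^ m ≤ 1 := pow_le_one₀ hθ0.le hθ1.le
      linarith
    · intro m
      have hrec : ∑' y, P (m + 1) y * Real.cos (phase k y)
          = (θ + θ⁻¹ + 4)⁻¹ * (∑' y, P (m + 2) y * Real.cos (phase k y)
            + ∑' y, P m y * Real.cos (phase k y)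
            + (4 - khatSq k) * ∑' y, P (m + 1) y * Real.cos (phase k y)) := by
        rw [← layerKer_tsum_neighbours (hsum (m + 1)) (hP0 (m + 1)) k,
          ← (hFs _).tsum_add (hFs _), ← Summable.tsum_add ((hFs _).add (hFs _)), ← tsum_mul_left]
        · refine tsum_congr fun y => ?_
          rw [hPrec m y]
          ring
        · exact (layerKer_summable_mul_cos
            (summable_sum fun j _ => ((Equiv.addRight (Pi.single j (1 : ℤ))).summable_iff.2
              (hsum (m + 1))).add ((Equiv.subRight (Pi.single j (1 : ℤ))).summable_iff.2
              (hsum (m + 1))))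
            (fun y => Finset.sum_nonneg fun j _ => add_nonneg (hP0 _ _) (hP0 _ _)) _)
      have hT0 : θ + θ⁻¹ + 4 ≠ 0 := by positivity
      have h' : (θ + θ⁻¹ + 4) * ∑' y, P (m + 1) y * Real.cos (phase k y)
          = ∑' y, P (m + 2) y * Real.cos (phase k y) + ∑' y, P m y * Real.cos (phase k y)
            + (4 - khatSq k) * ∑' y, P (m + 1) y * Real.cos (phase k y) := by
        conv_lhs => rw [hrec, ← mul_assoc, mul_inv_cancel₀ hT0, one_mul]
      linear_combination -h'
  rw [← key n]
  exact (hFs n).hasSum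

end Summit.CriticalPhenomena.Ising3DConformalLimit.Theorems.PerfectScreening.KlBand

end
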